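import Summits.KontsevichZagierPeriods.KontsevichZagierPeriods.Theorems.LinRedNormalFormArrangementNormalFormStubSeparateZeroTools

/-!
# Stub `stub_separateZero` (crux `ArrangementNormalForm`, line `janus-bands`) — part `Marginals`

Measure theory on `ℝ^N` through Mathlib's marginal integrals `∫⋯∫⁻` (no measurable equivalences):
a measurable set with null sections is null, coordinate hyperplane-graphs and cylinders over null
sets are null, the one-dimensional divergence `∫ |x − v|⁻¹ = ∞`, the DIVERGENCE LEMMA
(`n · vol S ≤ ∫_S |z_b − V(z_o)|⁻¹` when the `b`-sections of `S` reach `V`), and Tonelli for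
product majorants `g(z_o) ∏ᵢ ψᵢ(z_o, z_{fi i})`.
-/

noncomputable section

open Set MeasureTheory
open Literature.NumberTheory.Transcendental
open scoped ENNReal

namespace Summit.KontsevichZagierPeriods.ArrangementNormalForm.JanusBands

namespace SepZero

variable {N : ℕ}

/-! ### Sections, null hyperplanes, divergence -/


/-- A measurable set all of whose sections in the coordinate `b` are null is null
(Tonelli through the marginal `∫⋯∫⁻_{b}`). -/
theorem volume_eq_zero_of_sections (S : Set (Fin N → ℝ)) (hS : MeasurableSet S) (b : Fin N)
    (h : ∀ w : Fin N → ℝ, volume {x : ℝ | Function.update w b x ∈ S} = 0) : volume S = 0 := by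
  classical
  have hm : Measurable (S.indicator (1 : (Fin N → ℝ) → ℝ≥0∞)) := measurable_one.indicator hS
  have key : ∫⁻ z, S.indicator (1 : (Fin N → ℝ) → ℝ≥0∞) z
      ∂Measure.pi (fun _ : Fin N => (volume : Measure ℝ)) =
      ∫⁻ _z, (0 : ℝ≥0∞) ∂Measure.pi (fun _ : Fin N => (volume : Measure ℝ)) := by
    refine lintegral_eq_of_lmarginal_eq {b} hm measurable_const ?_
    rw [lmarginal_singleton, lmarginal_singleton]
    funext w
    have hsec : MeasurableSet {x : ℝ | Function.update w b x ∈ S} :=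
      hS.preimage (measurable_update w)
    simp only [lintegral_const, zero_mul]
    have : (fun x : ℝ => S.indicator (1 : (Fin N → ℝ) → ℝ≥0∞) (Function.update w b x)) =
        {x : ℝ | Function.update w b x ∈ S}.indicator 1 := by
      funext x; by_cases hx : Function.update w b x ∈ S <;> simp [hx]
    rw [this, lintegral_indicator_one hsec, h w]
  rw [← volume_pi, lintegral_indicator_one hS, lintegral_zero] at key
  exact key

/-- A coordinate hyperplane-graph `{z | z b = φ z}` with `φ` independent of `z b` is null. -/
theorem volume_graph_eq_zero (b : Fin N) (φ : (Fin N → ℝ) → ℝ) (hφ : Measurable φ)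
    (hind : ∀ z x, φ (Function.update z b x) = φ z) : volume {z : Fin N → ℝ | z b = φ z} = 0 := by
  classical
  refine volume_eq_zero_of_sections _ (measurableSet_eq_fun (measurable_pi_apply b) hφ) b fun w => ?_
  have : {x : ℝ | Function.update w b x ∈ {z : Fin N → ℝ | z b = φ z}} = {φ w} := by
    ext x; simp [hind]
  rw [this, measure_singleton]

/-- A cylinder `{z | z b ∈ T}` over a null set `T ⊆ ℝ` is null. -/
theorem volume_cylinder_eq_zero (b : Fin N) {T : Set ℝ} (hT : MeasurableSet T)
    (h0 : volume T = 0) : volume {z : Fin N → ℝ | z b ∈ T} = 0 := by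
  classical
  refine volume_eq_zero_of_sections _ (hT.preimage (measurable_pi_apply b)) b fun w => ?_
  have : {x : ℝ | Function.update w b x ∈ {z : Fin N → ℝ | z b ∈ T}} = T := by
    ext x; simp
  rw [this, h0]

/-- One-dimensional divergence: `∫_{(v, x₀)} |x − v|⁻¹ dx = ∞` (either orientation). -/
theorem lintegral_inv_abs_sub_eq_top {v x₀ : ℝ} (h : x₀ ≠ v) :
    ∫⁻ x in Set.uIoo v x₀, ENNReal.ofReal |x - v|⁻¹ = ⊤ := by
  have hni : ¬ IntervalIntegrable (fun x : ℝ => (x - v)⁻¹) volume v x₀ := by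
    intro hint
    have := (hint.comp_add_right v)
    simp only [add_sub_cancel_right, sub_self] at this
    rcases intervalIntegrable_inv_iff.1 this with h1 | h1
    · exact h (by linarith)
    · exact h1 (by simp)
  rw [intervalIntegrable_iff] at hni
  have hmeas : AEStronglyMeasurable (fun x : ℝ => (x - v)⁻¹) (volume.restrict (uIoc v x₀)) :=
    ((measurable_id.sub_const v).inv).aestronglyMeasurable
  have htop : ∫⁻ x in uIoc v x₀, ‖(x - v)⁻¹‖ₑ = ⊤ := by
    by_contra hne
    exact hni ⟨hmeas, (hasFiniteIntegral_iff_enorm.2 (lt_top_iff_ne_top.2 hne))⟩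
  have hae : (uIoo v x₀ : Set ℝ) =ᵐ[volume] uIoc v x₀ := by
    rw [uIoo, uIoc]
    exact Ioo_ae_eq_Ioc
  rw [Measure.restrict_congr_set hae, ← htop]
  refine lintegral_congr fun x => ?_
  rw [Real.enorm_eq_ofReal_abs, abs_inv]

/-- **Divergence lemma.** Let `S` be measurable and, in the coordinate `b ≠ o`, every section of
`S` through a point `z` contain the open interval between `V (z o)` and `z b`. Then
`n · vol S ≤ ∫_S |z_b − V(z_o)|⁻¹` for every `n`; in particular the integral is infinite unless
`S` is null. -/
theorem mul_volume_le_lintegral_inv (S : Set (Fin N → ℝ)) (hS : MeasurableSet S) (b o : Fin N)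
    (hbo : b ≠ o) (V : ℝ → ℝ) (hV : Measurable V)
    (hsec : ∀ z ∈ S, ∀ x ∈ Set.uIoo (V (z o)) (z b), Function.update z b x ∈ S) (n : ℕ) :
    (n : ℝ≥0∞) * volume S ≤ ∫⁻ z in S, ENNReal.ofReal |z b - V (z o)|⁻¹ := by
  classical
  set g : (Fin N → ℝ) → ℝ≥0∞ := fun z => ENNReal.ofReal |z b - V (z o)|⁻¹ with hg
  have hgm : Measurable g :=
    (((measurable_pi_apply b).sub (hV.comp (measurable_pi_apply o))).abs.inv).ennreal_ofReal
  have hfm : Measurable (S.indicator (fun _ => (n : ℝ≥0∞))) := measurable_const.indicator hS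
  have hgm' : Measurable (S.indicator g) := hgm.indicator hS
  have key : ∫⁻ z, S.indicator (fun _ => (n : ℝ≥0∞)) z
      ∂Measure.pi (fun _ : Fin N => (volume : Measure ℝ)) ≤
      ∫⁻ z, S.indicator g z ∂Measure.pi (fun _ : Fin N => (volume : Measure ℝ)) := by
    refine lintegral_le_of_lmarginal_le {b} hfm hgm' ?_
    rw [lmarginal_singleton, lmarginal_singleton]
    intro w
    simp only
    set sec : Set ℝ := {x | Function.update w b x ∈ S} with hsec_def
    have hsecm : MeasurableSet sec := hS.preimage (measurable_update w)
    have h1 : (fun x : ℝ => S.indicator (fun _ => (n : ℝ≥0∞)) (Function.update w b x)) =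
        sec.indicator fun _ => (n : ℝ≥0∞) := by
      funext x; by_cases hx : Function.update w b x ∈ S <;> simp [hx, hsec_def]
    have h2 : (fun x : ℝ => S.indicator g (Function.update w b x)) =
        sec.indicator fun x => ENNReal.ofReal |x - V (w o)|⁻¹ := by
      funext x
      by_cases hx : Function.update w b x ∈ S
      · rw [indicator_of_mem hx, indicator_of_mem (show x ∈ sec from hx), hg]
        simp [Function.update_of_ne hbo.symm]
      · rw [indicator_of_notMem hx, indicator_of_notMem (show x ∉ sec from hx)]
    rw [h1, h2, lintegral_indicator hsecm, lintegral_indicator hsecm]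
    by_cases hne : ∃ x₀ ∈ sec, x₀ ≠ V (w o)
    · obtain ⟨x₀, hx₀, hx₀V⟩ := hne
      have hsub : Set.uIoo (V (w o)) x₀ ⊆ sec := by
        intro x hx
        have := hsec _ hx₀ x (by simpa [Function.update_of_ne hbo.symm] using hx)
        simpa [hsec_def] using this
      refine le_trans le_top (le_of_eq ?_)
      symm
      exact eq_top_mono (lintegral_mono_set hsub) (lintegral_inv_abs_sub_eq_top hx₀V)
    · push Not at hne
      have hsub : sec ⊆ {V (w o)} := fun x hx => hne x hx
      have h0 : volume sec = 0 := measure_mono_null hsub (measure_singleton _)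
      rw [setLIntegral_measure_zero _ _ h0]
      exact zero_le
  rw [← volume_pi, lintegral_indicator hS, lintegral_indicator hS, setLIntegral_const] at key
  exact key

/-- Corollary: under the hypotheses of `mul_volume_le_lintegral_inv`, if a function `f ≥ c·|z_b − V|⁻¹`
(`c > 0`) is integrable on `S`, then `S` is null. -/
theorem volume_eq_zero_of_integrableOn (S : Set (Fin N → ℝ)) (hS : MeasurableSet S) (b o : Fin N)
    (hbo : b ≠ o) (V : ℝ → ℝ) (hV : Measurable V)
    (hsec : ∀ z ∈ S, ∀ x ∈ Set.uIoo (V (z o)) (z b), Function.update z b x ∈ S)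
    {f : (Fin N → ℝ) → ℝ} {c : ℝ} (hc : 0 < c)
    (hf : ∀ z ∈ S, c * |z b - V (z o)|⁻¹ ≤ |f z|) (hint : IntegrableOn f S) : volume S = 0 := by
  by_contra hne
  have hpos : 0 < volume S := pos_iff_ne_zero.2 hne
  have h2 := hint.2
  rw [hasFiniteIntegral_iff_enorm] at h2
  -- ∫_S |z_b - V|⁻¹ ≤ c⁻¹ ∫_S ‖f‖ < ∞
  have hle : ∫⁻ z in S, ENNReal.ofReal |z b - V (z o)|⁻¹ ≤
      ENNReal.ofReal c⁻¹ * ∫⁻ z in S, ‖f z‖ₑ := by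
    rw [← lintegral_const_mul' _ _ ENNReal.ofReal_ne_top]
    refine setLIntegral_mono' hS fun z hz => ?_
    rw [Real.enorm_eq_ofReal_abs, ← ENNReal.ofReal_mul (inv_nonneg.2 hc.le)]
    refine ENNReal.ofReal_le_ofReal ?_
    rw [← div_le_iff₀' (inv_pos.2 hc), div_inv_eq_mul, mul_comm]
    exact hf z hz
  have hfin : ∫⁻ z in S, ENNReal.ofReal |z b - V (z o)|⁻¹ < ⊤ :=
    lt_of_le_of_lt hle (ENNReal.mul_lt_top ENNReal.ofReal_lt_top h2)
  -- but n · vol S ≤ it for all n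
  have hq : (∫⁻ z in S, ENNReal.ofReal |z b - V (z o)|⁻¹) / volume S ≠ ⊤ :=
    (ENNReal.div_lt_top hfin.ne hne).ne
  obtain ⟨n, hn⟩ := ENNReal.exists_nat_gt hq
  have key := mul_volume_le_lintegral_inv S hS b o hbo V hV hsec n
  have hle' : (n : ℝ≥0∞) ≤ (∫⁻ z in S, ENNReal.ofReal |z b - V (z o)|⁻¹) / volume S :=
    (ENNReal.le_div_iff_mul_le (Or.inl hne) (Or.inr hfin.ne)).2 key
  exact absurd (lt_of_le_of_lt hle' hn) (lt_irrefl _)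

/-! ### Tonelli for product majorants -/

/-- Marginal of a product majorant `g(z_o) ∏ᵢ ψᵢ(z_o, z_{fi i})` over a set of fibre coordinates:
the integrated factors become `∫ ψᵢ(z_o, t) dt`. -/
theorem lmarginal_prod_fibres {k : ℕ} (o : Fin N) (fi : Fin k ↪ Fin N) (hfo : ∀ i, fi i ≠ o)
    (g : ℝ → ℝ≥0∞) (hg : Measurable g) (ψ : Fin k → ℝ → ℝ → ℝ≥0∞)
    (hψ : ∀ i, Measurable (Function.uncurry (ψ i))) (s : Finset (Fin k)) (z : Fin N → ℝ) :
    (∫⋯∫⁻_(s.map fi), fun z => g (z o) * ∏ i, ψ i (z o) (z (fi i))) z =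
      g (z o) * (∏ i ∈ s, ∫⁻ t, ψ i (z o) t) * ∏ i ∈ sᶜ, ψ i (z o) (z (fi i)) := by
  classical
  have hF : Measurable fun z : Fin N → ℝ => g (z o) * ∏ i, ψ i (z o) (z (fi i)) :=
    (hg.comp (measurable_pi_apply o)).mul (Finset.measurable_prod _ fun i _ =>
      show Measurable ((Function.uncurry (ψ i)) ∘ fun z : Fin N → ℝ => (z o, z (fi i))) from
        (hψ i).comp ((measurable_pi_apply o).prodMk (measurable_pi_apply (fi i))))
  induction s using Finset.induction_on generalizing z with
  | empty => simp [lmarginal_empty]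
  | insert a s ha ih =>
    rw [Finset.map_insert, lmarginal_insert _ hF (by simpa using ha)]
    have hupd : ∀ x : ℝ, Function.update z (fi a) x o = z o := fun x =>
      Function.update_of_ne (hfo a).symm _ _
    have hstep : ∀ x : ℝ, (∫⋯∫⁻_(s.map fi), fun z => g (z o) * ∏ i, ψ i (z o) (z (fi i)))
        (Function.update z (fi a) x) = (g (z o) * (∏ i ∈ s, ∫⁻ t, ψ i (z o) t) *
          ∏ i ∈ (insert a s)ᶜ, ψ i (z o) (z (fi i))) * ψ a (z o) x := by
      intro x
      rw [ih, hupd, Finset.compl_insert]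
      have ha' : a ∈ sᶜ := Finset.mem_compl.2 ha
      rw [← Finset.mul_prod_erase _ _ ha', Function.update_self]
      have : ∏ i ∈ sᶜ.erase a, ψ i (z o) (Function.update z (fi a) x (fi i)) =
          ∏ i ∈ sᶜ.erase a, ψ i (z o) (z (fi i)) := by
        refine Finset.prod_congr rfl fun i hi => ?_
        rw [Function.update_of_ne (fun h => (Finset.ne_of_mem_erase hi) (fi.injective h))]
      rw [this]; ring
    simp_rw [hstep]
    have hma : Measurable fun x : ℝ => ψ a (z o) x :=
      show Measurable ((Function.uncurry (ψ a)) ∘ fun x : ℝ => (z o, x)) from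
        (hψ a).comp (measurable_const.prodMk measurable_id)
    rw [lintegral_const_mul _ hma, Finset.prod_insert ha]
    ring

/-- Tonelli for a product majorant when `o` and the fibre coordinates exhaust all coordinates:
`∫ g(z_o) ∏ᵢ ψᵢ(z_o, z_{fi i}) dz = ∫ g(y) ∏ᵢ (∫ ψᵢ(y, t) dt) dy`. -/
theorem lintegral_prod_fibres {k : ℕ} (o : Fin N) (fi : Fin k ↪ Fin N) (hfo : ∀ i, fi i ≠ o)
    (hcov : ∀ j : Fin N, j ≠ o → ∃ i, fi i = j)
    (g : ℝ → ℝ≥0∞) (hg : Measurable g) (ψ : Fin k → ℝ → ℝ → ℝ≥0∞)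
    (hψ : ∀ i, Measurable (Function.uncurry (ψ i))) :
    ∫⁻ z : Fin N → ℝ, g (z o) * ∏ i, ψ i (z o) (z (fi i)) = ∫⁻ y, g y * ∏ i, ∫⁻ t, ψ i y t := by
  classical
  have hF : Measurable fun z : Fin N → ℝ => g (z o) * ∏ i, ψ i (z o) (z (fi i)) :=
    (hg.comp (measurable_pi_apply o)).mul (Finset.measurable_prod _ fun i _ =>
      show Measurable ((Function.uncurry (ψ i)) ∘ fun z : Fin N → ℝ => (z o, z (fi i))) from
        (hψ i).comp ((measurable_pi_apply o).prodMk (measurable_pi_apply (fi i))))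
  have huniv : (Finset.univ : Finset (Fin N)) = insert o (Finset.univ.map fi) := by
    ext j
    simp only [Finset.mem_univ, Finset.mem_insert, Finset.mem_map, true_and, true_iff]
    by_cases hj : j = o
    · exact Or.inl hj
    · obtain ⟨i, hi⟩ := hcov j hj
      exact Or.inr ⟨i, hi⟩
  have ho : o ∉ Finset.univ.map fi := by simpa using fun i => hfo i
  rw [volume_pi, lintegral_eq_lmarginal_univ (fun _ => (0:ℝ)), huniv, lmarginal_insert _ hF ho]
  refine lintegral_congr fun y => ?_
  rw [lmarginal_prod_fibres o fi hfo g hg ψ hψ]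
  simp

end SepZero

/-- Registered support goal of this file: a coordinate hyperplane-graph is Lebesgue null. -/
theorem separateZero_marginals (N : ℕ) (b : Fin N) (φ : (Fin N → ℝ) → ℝ) (hφ : Measurable φ) (hind : ∀ z x, φ (Function.update z b x) = φ z) : MeasureTheory.volume {z : Fin N → ℝ | z b = φ z} = 0 :=
  SepZero.volume_graph_eq_zero b φ hφ hind

end Summit.KontsevichZagierPeriods.ArrangementNormalForm.JanusBands
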